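import Mathlib
import Literature.NumberTheory.LFunctions.Zhang2022.Section7MeanSquareMajorant

/-!
# Zhang (2022) §14, (14.3) at its call sites (15.5) and (16.1): the mean-square majorants of `κ₁ ∗ b` and `κ₂ ∗ b₁` (exponent `9`), and the printed divisor-function counts (exponents `25` and `4`)

Trunk T-ANT (NumberTheory/LFunctions). Y. Zhang, *Discrete mean estimates and the Landau–Siegel
zero*, arXiv:2211.02515v1 (2022) [Zhang2022LandauSiegel], §14 (Proposition 14.1, hypotheses (14.1),
(14.2), display (14.3)) [p. 28 of the source], §15 ((15.1), (15.2), (15.5)) [p. 30], §16 ((16.1) and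
the definitions of `κ₂`, `b₁`) [p. 33], with §6 (Lemma 6.1: `N(s,ψ)`) [p. 12], §7 (7.5) [p. 13],
(2.10) [p. 4], (2.13) [p. 5]. **Status of the source: an unrefereed manuscript, a claimed result
under adjudication** (cell pub-zhang: audit + repair census of arXiv:2211.02515; no claim about
Landau–Siegel). This file is the sequel of `Zhang2022.Section7MeanSquareMajorant` (cell ALT seat 3,
`HOME/ALT-3.md` §B3, §G1), whose module docstring lists as "deliberately NOT here" exactly the two
Proposition 14.1 call sites treated below.

The source, §14 [p. 28]: "Let `k* = {κ*(m)}` and `a* = {a*(n)}` denote sequences of complex numbers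
satisfying `κ*(m) ≪ τ₅(m)` (14.1), `a*(n) ≪ 1`, `a*(n) = 0` if `n > 2P₄` (14.2). … Proposition 14.1.
Suppose `|β| < 5α`. Then `Θ₂(β, k*, a*) = … + o(𝔓)`. Proof. … Similar to the proof of
Proposition 7.1, in the expression for `Θ₂`, we can extend the sum over `Ψ₁` to the sum over `Ψ`,
with acceptable errors. Namely we have `Θ₂ = ∑_{ψ∈Ψ} Ĩ₂(ψ) + o(𝔓)` (14.3)". The extension step is
the one of (7.5) [p. 13] — Cauchy, the large sieve (Lemma 3.3 (ii)) for `∑_ψ |∑_{m<P²} κ*(m)ψ(m)m^{-s}|²`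
and for the fourth moment of the `a*`-polynomial, Proposition 2.1 for `#Ψ₂` — and what it reads off
the coefficient sequences is the pair of logarithmic mean squares `∑_{m<P²} |κ*(m)|²/m` and
`∑_n |(a* ∗ a*)(n)|²/n` (cell template "T75": requirement `xP21 > 2·k_κ·e_P + k_a·e_P + 3·e_𝔓` on the
exceptional-set exponent, rows X-14.03a / III-14.03a of `HOME/CONSTRAINTS-v5.json`, printed values
`k_κ = k5tau = 25`, `k_a = k2tau = 4`, threshold `717`). The two call sites:

* (15.5) [p. 30]: `κ₁*(m) = (κ₁ ∗ b)(m)`, `a₁*(n) = g̃₃(n) = n^{β₃} g*(P₄/n)`, where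
  `∑_m κ₁(m) m^{-s} = ζ(s+β₁)ζ(s+β₂)/ζ(s)` [p. 30] and `b` is the coefficient sequence of
  `B(s,ψ) = ∑_n b(n)(ψχ)(n)n^{-s}` (15.1) with `b(n) ≪ τ₂(n)`, `b(n) = 0` if `n > PT^{-2}η₊` (15.2)
  (`B = (H₁₄ + ι₂H₁₂)H₂` by (12.2) [p. 24], a product of two polynomials with bounded coefficients);
* (16.1) [p. 33]: `κ₂* = κ₂ ∗ b₁`, `a₂* = g̃₂`, where `∑_n κ₂(n) n^{-s} = ζ(s+β₁)/ζ(s)` and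
  `∑_n b₁(n)ψ(n)n^{-s} = B(s,ψ)N(s+β₃,ψ)` [p. 33] with `N(s,ψ) = ∑_n ψ(n)n^{-s} g*(T²/n)` (Lemma 6.1
  [p. 12]), so that `b₁ = b ⋆ c` with `|c(n)| = |n^{-β₃} g*(T²/n)| ≤ sup|g|` — hence `|b₁| ≪ τ₂ ⋆ 𝟙 = τ₃`.
  (Whether or not the real character `χ` of (15.1) is absorbed into `b`, only `|b| ≪ τ₂` enters.)

By (2.13) the shifts are PURELY IMAGINARY, `β_j = i b_j` with `|b₁| + |b₂| ≤ 3α`, `|b₁| ≤ α(1 − 5c′α𝓛)`,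
and `α log P² = 2π` by (2.10).

## What this file PROVES (elementary; every bound is an instance of the tree's Euler-product majorant `MeanSquareMajorant.sum_div_le` / `sum_sq_div_le` = Hall–Tenenbaum (0.4) [HallTenenbaum1988] + Chebyshev–Mertens)

* `tau j = ζ^j`, the generalized divisor function `τ_j` as a real arithmetic function (`tau_prime :
  τ_j(p) = j`, `tau_prime_pow_le : τ_j(p^ν) ≤ (ν+1)^j`, `tau_two_apply : τ₂(n) = #divisors(n)`,
  `isMultiplicative_tau`); `seqConv u v` = Dirichlet convolution of two sequences and
  `norm_seqConv_le_tau : |u| ≤ C₁τ_{j₁} ∧ |v| ≤ C₂τ_{j₂} ⇒ |u ⋆ v| ≤ C₁C₂ τ_{j₁+j₂}` (so `b₁ ≪ τ₃`);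
* THE PRINTED COUNTS as upper bounds: `sum_tau_sq_div_le : ∑_{n≤X} τ_j(n)²/n ≤ majorantConst (j²) (2j) ·
  (log X)^{j²}` (`X ≥ 2`), in particular exponents `25` for `τ₅` (14.1)/(7.5) and `4` for `τ₂`, and
  `sum_norm_seqConv_sq_div_le : |a| ≤ C ⇒ ∑_{n≤X} |(a ⋆ a)(n)|²/n ≤ C⁴ · majorantConst 4 4 · (log X)⁴`
  (the fourth-moment side of (7.5)/(14.3) for `a* ≪ 1`, exponent `k2tau = 4`);
* THE GENERAL MAJORANT `sum_norm_conv_sq_div_le_of_le_tau`: `κ : ArithmeticFunction ℂ` multiplicative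
  with `|κ(p)| ≤ a₀ + B log p`, `|κ(p)| ≤ A₀`, `|κ(p^i)| ≤ (i+1)^c`, and a sequence `w` with
  `|w(n)| ≤ C τ_j(n)` (`n ≥ 1`), where `a₀ + j ≤ 3`, `A₀ + j ≤ 5`: for `X ≥ 2`,
  `∑_{m≤X} |(κ ∗ w)(m)|²/m ≤ C² · majorantConst 9 (2(c+j+1)) · exp(16B log 4X) · (log X)^9`
  (pointwise `|(κ ∗ w)(m)| ≤ C (|κ| ∗ τ_j)(m)`, `absConvTau`, and `(|κ| ∗ τ_j)(p) = |κ(p)| + j`);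
* THE TWO INSTANCES: `kappa₁ b₁ b₂ = n^{-ib₁} ∗ n^{-ib₂} ∗ μ` (`κ₁(p) = p^{-β₁} + p^{-β₂} − 1`,
  `|κ₁(p)| ≤ 1 + (|b₁|+|b₂|) log p`, `|κ₁(p)| ≤ 3`, `|κ₁(p^k)| ≤ (k+1)²`) and
  `kappa₂ b₁ = n^{-ib₁} ∗ μ` (`κ₂(p) = p^{-β₁} − 1`, `|κ₂(p)| ≤ |b₁| log p`, `|κ₂(p)| ≤ 2`,
  `|κ₂(p^k)| ≤ k+1`), whence
  `sum_norm_kappa₁_conv_sq_div_le` — (15.5): `|b| ≤ Cτ₂ ⇒ ∑_{m≤X} |(κ₁ ∗ b)(m)|²/m ≤ C² · majorantConst 9 10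
  · exp(16(|b₁|+|b₂|) log 4X) · (log X)^9`, and
  `sum_norm_kappa₂_conv_sq_div_le` — (16.1): `|b₁| ≤ Cτ₃ ⇒ ∑_{m≤X} |(κ₂ ∗ b₁)(m)|²/m ≤ C² · majorantConst
  9 10 · exp(16|b₁| log 4X) · (log X)^9`; with the source's normalisation (`(|b₁|+|b₂|) log X ≤ L`,
  resp. `|b₁| log X ≤ L`, `X ≥ 4`; at `X = P²`: `L = 6π`, resp. `2π`) the middle factor is `≤ e^{32L}`
  (`…_of_mul_log_le`). So the hypothesis "(14.1′) `∑_{m<P²} |κ*(m)|²/m ≪ (log P²)^k` with `k = 9`" of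
  the cell's variant system MV-E holds at both Proposition 14.1 call sites (rows X-ALT3.14.03a/b of
  `HOME/b2b-zhang-alt-3/alt3_rows_v4.json`; by-hand count in ALT-3.md §B3: `(1+2)² = 9`, `(0+3)² = 9`),
  exactly as `Section7MeanSquareMajorant` proved it at (7.5) (`(2+1)² = 9`).

Numbers, not adjectives: the constants are absurd as numbers and not optimised (`majorantConst 9 10 =
exp(36 + S₁₀)`, `S₁₀ = ∑_ν (ν+3)^{10} 2^{-ν}`), `X`-independent; only the EXPONENT of `log X` (`9` in
place of the printed `25`) is what the cell's exponent layer reads. The mechanism is the one of (7.5):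
at a prime the majorant `|κ| ∗ τ_j` takes the value `|κ(p)| + j`, and the imaginary shifts make
`|κ₁(p)| → 1`, `|κ₂(p)| → 0` up to `(∑|b_j|) log p`, whose prime sum `∑_{p≤X} (log p)/p ≤ log 4X` is
absorbed into the `X`-independent factor `exp(16B log 4X) ≤ e^{32L}`.

Scope (deliberately NOT here): Proposition 14.1 itself and its error terms, the large sieve / Hölder
step (`Section3MeanValues`), the supports (15.2)/(14.2) (irrelevant to a logarithmic mean square over
`m ≤ X`), the identities `∑ κ₁(n)n^{-s} = ζ(s+β₁)ζ(s+β₂)/ζ(s)` etc. as `LSeries` statements (`kappa₁`,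
`kappa₂` are DEFINED as the Dirichlet convolutions of the coefficient sequences, which is that identity
at the level of coefficients), and the further `Ψ₁ → Ψ` extension sites (15.4), (17.2), (17.7) of the
source. Nothing here bears on the cell's verdict on (8.24)/(2.32) (`Section8Certificate.not_ineq824`);
no statement about Theorems 1–2 of the source is made or implied. The ℕ-valued twins of `tau_succ_apply`,
`isMultiplicative_tau`, `tau_apply_one` exist in the tree as `SatheSelberg.zeta_pow_succ_apply`,
`isMultiplicative_zeta_pow`, `zeta_pow_apply_one` (`SatheSelbergMeanValue.lean`, not imported here to
keep this file's imports to Mathlib + the §7 companion).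
-/

noncomputable section

open Finset Real ArithmeticFunction

namespace Literature.NumberTheory.LFunctions.Zhang2022.MeanSquareMajorant

/-! ### Part 1. The generalized divisor functions `τ_j = ζ^j` as real arithmetic functions -/

/-- `tau j = ζ^j`: the generalized divisor function `τ_j` (`τ_j(n)` = the number of ordered
factorisations of `n ≥ 1` into `j` factors; `τ₁ = 𝟙`, `τ₂ = τ` the number of divisors), as a REAL
arithmetic function — the source's `τ_k(m)` of (7.5), (14.1), (15.2). [folklore] -/
def tau (j : ℕ) : ArithmeticFunction ℝ := (ArithmeticFunction.zeta : ArithmeticFunction ℝ) ^ j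

/-- `τ₀ = 1` (the Dirichlet unit). [folklore] -/
theorem tau_zero : tau 0 = 1 := pow_zero _

/-- `τ_{j+1} = τ_j ∗ ζ`. [folklore] -/
theorem tau_succ (j : ℕ) : tau (j + 1) = tau j * (ArithmeticFunction.zeta : ArithmeticFunction ℝ) :=
  pow_succ _ _

/-- `τ_{j+1}(n) = ∑_{d ∣ n} τ_j(d)`. [folklore] -/
theorem tau_succ_apply (j n : ℕ) : tau (j + 1) n = ∑ d ∈ n.divisors, tau j d := by
  rw [tau_succ, coe_mul_zeta_apply]

/-- `τ_j` is multiplicative. [folklore] -/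
theorem isMultiplicative_tau (j : ℕ) : (tau j).IsMultiplicative := by
  induction j with
  | zero => rw [tau_zero]; exact isMultiplicative_one
  | succ j ih => rw [tau_succ]; exact ih.mul isMultiplicative_zeta.natCast

/-- `τ_j(1) = 1`. [folklore] -/
theorem tau_apply_one (j : ℕ) : tau j 1 = 1 := (isMultiplicative_tau j).map_one

/-- `0 ≤ τ_j(n)`. [folklore] -/
theorem tau_nonneg (j n : ℕ) : 0 ≤ tau j n := by
  induction j generalizing n with
  | zero => rw [tau_zero, ArithmeticFunction.one_apply]; split_ifs <;> norm_num
  | succ j ih => rw [tau_succ_apply]; exact sum_nonneg fun d _ => ih d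

/-- `τ₁(n) = 1` for `n ≥ 1`. [folklore] -/
theorem tau_one_apply {n : ℕ} (hn : n ≠ 0) : tau 1 n = 1 := by
  rw [tau, pow_one, natCoe_apply, zeta_apply_ne hn, Nat.cast_one]

/-- `τ₂(n)` is the number of divisors of `n`. [folklore] -/
theorem tau_two_apply (n : ℕ) : tau 2 n = n.divisors.card := by
  rw [show (2 : ℕ) = 1 + 1 from rfl, tau_succ_apply, card_eq_sum_ones, Nat.cast_sum]
  exact sum_congr rfl fun d hd => by
    rw [tau_one_apply (Nat.pos_of_mem_divisors hd).ne', Nat.cast_one]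

/-- `τ_j(p) = j` at a prime. [folklore] -/
theorem tau_prime (j : ℕ) {p : ℕ} (hp : p.Prime) : tau j p = j := by
  induction j with
  | zero => rw [tau_zero, one_apply_ne hp.one_lt.ne', Nat.cast_zero]
  | succ j ih =>
    rw [tau_succ_apply, hp.divisors, sum_pair hp.one_lt.ne, tau_apply_one, ih]
    push_cast; ring

/-- `τ_j(p^ν) ≤ (ν+1)^j` (indeed `= binom(ν+j−1, j−1)`). [folklore] -/
theorem tau_prime_pow_le (j : ℕ) {p : ℕ} (hp : p.Prime) (ν : ℕ) :
    tau j (p ^ ν) ≤ ((ν : ℝ) + 1) ^ j := by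
  induction j generalizing ν with
  | zero => rw [tau_zero, pow_zero, ArithmeticFunction.one_apply]; split_ifs <;> norm_num
  | succ j ih =>
    rw [tau_succ_apply, Nat.sum_divisors_prime_pow hp]
    calc ∑ i ∈ range (ν + 1), tau j (p ^ i) ≤ ∑ i ∈ range (ν + 1), ((ν : ℝ) + 1) ^ j :=
          sum_le_sum fun i hi => (ih i).trans (by
            have h : i + 1 ≤ ν + 1 := by have := mem_range.1 hi; omega
            have h' : (i : ℝ) + 1 ≤ (ν : ℝ) + 1 := by exact_mod_cast h
            exact pow_le_pow_left₀ (by positivity) h' j)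
      _ = ((ν : ℝ) + 1) ^ (j + 1) := by
          rw [sum_const, card_range, nsmul_eq_mul, pow_succ]; push_cast; ring

/-- **The printed divisor-function counts, as upper bounds.** For `X ≥ 2`,
`∑_{n≤X} τ_j(n)²/n ≤ majorantConst (j²) (2j) · (log X)^{j²}` (`τ_j(p)² = j²`, `τ_j(p^ν)² ≤ (ν+1)^{2j}`;
`sum_div_le` with `K = 0`). With `j = 5` this is the source's `∑_{m<P²} τ₅(m)²/m ≪ (log P²)^{25}` of
(7.5)/(14.1) (cell parameter `k5tau = 25`), with `j = 2` its `∑ τ₂(m)²/m ≪ (log P²)^4` (`k2tau = 4`).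
[folklore] -/
theorem sum_tau_sq_div_le (j : ℕ) {X : ℕ} (hX : 2 ≤ X) :
    ∑ n ∈ Icc 1 X, tau j n ^ 2 / n ≤ majorantConst (j ^ 2) (2 * j) * Real.log X ^ (j ^ 2) := by
  have hmul := isMultiplicative_tau j
  have h := sum_div_le (f := fun n => tau j n ^ 2) (a := j ^ 2) (d := 2 * j) (K := 0)
    (by simp [tau_apply_one]) (fun m n hmn => by simp only [hmul.map_mul_of_coprime hmn]; ring)
    (fun n => sq_nonneg _) le_rfl
    (fun p hp => by norm_num [tau_prime j hp])
    (fun p ν hp => by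
      calc tau j (p ^ ν) ^ 2 ≤ (((ν : ℝ) + 1) ^ j) ^ 2 :=
            pow_le_pow_left₀ (tau_nonneg _ _) (tau_prime_pow_le j hp ν) 2
        _ = ((ν : ℝ) + 1) ^ (2 * j) := by rw [← pow_mul, mul_comm]) hX
  simpa only [zero_mul, Real.exp_zero, mul_one] using h

/-! ### Part 2. Dirichlet convolution of two sequences; `|u| ≪ τ_{j₁}`, `|v| ≪ τ_{j₂}` ⇒ `|u ⋆ v| ≪ τ_{j₁+j₂}` -/

/-- `(u ⋆ v)(n) = ∑_{n = k l} u(k) v(l)`, the Dirichlet convolution of two sequences (coefficient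
sequence of a product of two Dirichlet series). [folklore] -/
def seqConv (u v : ℕ → ℂ) (n : ℕ) : ℂ :=
  ∑ x ∈ n.divisorsAntidiagonal, u x.1 * v x.2

/-- `τ_{j₁+j₂}(n) = ∑_{n = k l} τ_{j₁}(k) τ_{j₂}(l)`. [folklore] -/
theorem tau_add_apply (j₁ j₂ n : ℕ) :
    tau (j₁ + j₂) n = ∑ x ∈ n.divisorsAntidiagonal, tau j₁ x.1 * tau j₂ x.2 := by
  unfold tau; rw [pow_add, mul_apply]

/-- **Divisor-type majorants multiply under convolution.** If `|u(n)| ≤ C₁ τ_{j₁}(n)` and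
`|v(n)| ≤ C₂ τ_{j₂}(n)` for `n ≥ 1` (`C₁ ≥ 0`) then `|(u ⋆ v)(n)| ≤ C₁C₂ τ_{j₁+j₂}(n)` for all `n`
(both sides vanish at `n = 0`).
In the source: `b ≪ τ₂` ((15.2); `B = (H₁₄ + ι₂H₁₂)H₂`, two bounded-coefficient factors, `τ₁ ⋆ τ₁`)
and `b₁ = b ⋆ (n^{-β₃}g*(T²/n)) ≪ τ₂ ⋆ τ₁ = τ₃` ((16.1), Lemma 6.1). [folklore] -/
theorem norm_seqConv_le_tau {u v : ℕ → ℂ} {C₁ C₂ : ℝ} {j₁ j₂ : ℕ} (hC₁ : 0 ≤ C₁)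
    (hu : ∀ n, n ≠ 0 → ‖u n‖ ≤ C₁ * tau j₁ n) (hv : ∀ n, n ≠ 0 → ‖v n‖ ≤ C₂ * tau j₂ n)
    (n : ℕ) : ‖seqConv u v n‖ ≤ C₁ * C₂ * tau (j₁ + j₂) n := by
  rw [tau_add_apply, mul_sum]
  calc ‖seqConv u v n‖ ≤ ∑ x ∈ n.divisorsAntidiagonal, ‖u x.1 * v x.2‖ := norm_sum_le _ _
    _ ≤ ∑ x ∈ n.divisorsAntidiagonal, C₁ * C₂ * (tau j₁ x.1 * tau j₂ x.2) :=
        sum_le_sum fun x hx => by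
          have hx' := Nat.mem_divisorsAntidiagonal.1 hx
          have h1 : x.1 ≠ 0 := by intro h; apply hx'.2; rw [← hx'.1, h, zero_mul]
          have h2 : x.2 ≠ 0 := by intro h; apply hx'.2; rw [← hx'.1, h, mul_zero]
          rw [norm_mul]
          calc ‖u x.1‖ * ‖v x.2‖ ≤ (C₁ * tau j₁ x.1) * (C₂ * tau j₂ x.2) :=
                mul_le_mul (hu _ h1) (hv _ h2) (norm_nonneg _) (mul_nonneg hC₁ (tau_nonneg _ _))
            _ = C₁ * C₂ * (tau j₁ x.1 * tau j₂ x.2) := by ring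

/-- **(15.2) from (12.2): two bounded-coefficient factors give `b ≪ τ₂`.** If `|u(n)| ≤ C₁` and
`|v(n)| ≤ C₂` for `n ≥ 1` (`C₁ ≥ 0`) then `|(u ⋆ v)(n)| ≤ C₁C₂ τ₂(n)`. In the source
`B(s,ψ) = (H₁₄ + ι₂H₁₂)(s,ψ) H₂(s,ψ)` (12.2) [p. 24] with `H₂, H₁₂, H₁₄` Dirichlet polynomials with
bounded coefficients (§10–§11), whence (15.2) `b(n) ≪ τ₂(n)` [p. 30]. [cite: Zhang2022LandauSiegel, §15 (15.2) p. 30, §12 (12.2) p. 24] -/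
theorem norm_seqConv_le_tau_two {u v : ℕ → ℂ} {C₁ C₂ : ℝ} (hC₁ : 0 ≤ C₁)
    (hu : ∀ n, n ≠ 0 → ‖u n‖ ≤ C₁) (hv : ∀ n, n ≠ 0 → ‖v n‖ ≤ C₂) (n : ℕ) :
    ‖seqConv u v n‖ ≤ C₁ * C₂ * tau 2 n :=
  norm_seqConv_le_tau hC₁ (j₁ := 1) (j₂ := 1)
    (fun n hn => by rw [tau_one_apply hn, mul_one]; exact hu n hn)
    (fun n hn => by rw [tau_one_apply hn, mul_one]; exact hv n hn) n

/-- **`b₁ ≪ τ₃` at (16.1).** If `|b(n)| ≤ C₁ τ₂(n)` and `|c(n)| ≤ C₂` for `n ≥ 1` (`C₁ ≥ 0`) then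
`|(b ⋆ c)(n)| ≤ C₁C₂ τ₃(n)`. In the source `∑_n b₁(n)ψ(n)n^{-s} = B(s,ψ)N(s+β₃,ψ)` [p. 33]
with `N(s,ψ) = ∑_n ψ(n)n^{-s} g*(T²/n)` (Lemma 6.1 [p. 12]), i.e. `b₁ = b ⋆ c`, `c(n) = n^{-β₃}g*(T²/n)`,
`|c(n)| ≤ sup|g*|` (`β₃` purely imaginary). [cite: Zhang2022LandauSiegel, §16 p. 33, Lemma 6.1 p. 12] -/
theorem norm_seqConv_le_tau_three {b c : ℕ → ℂ} {C₁ C₂ : ℝ} (hC₁ : 0 ≤ C₁)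
    (hb : ∀ n, n ≠ 0 → ‖b n‖ ≤ C₁ * tau 2 n) (hc : ∀ n, n ≠ 0 → ‖c n‖ ≤ C₂) (n : ℕ) :
    ‖seqConv b c n‖ ≤ C₁ * C₂ * tau 3 n :=
  norm_seqConv_le_tau hC₁ (j₁ := 2) (j₂ := 1) hb
    (fun n hn => by rw [tau_one_apply hn, mul_one]; exact hc n hn) n

/-- **The fourth-moment side of (7.5)/(14.3), exponent `4`.** If `|a(n)| ≤ C` for `n ≥ 1` then for
`X ≥ 2`, `∑_{n≤X} |(a ⋆ a)(n)|²/n ≤ C⁴ · majorantConst 4 4 · (log X)^4` (`|a ⋆ a| ≤ C² τ₂`, then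
`sum_tau_sq_div_le 2`). In the source `a = a₂` (7.2) resp. `a*` (14.2), `≪ 1`, and the count is
`P² ∑_{m<P²} τ₂(m)²/m` [p. 13] (cell parameter `k2tau = 4`). [folklore] -/
theorem sum_norm_seqConv_sq_div_le {a : ℕ → ℂ} {C : ℝ} (ha : ∀ n, n ≠ 0 → ‖a n‖ ≤ C)
    {X : ℕ} (hX : 2 ≤ X) :
    ∑ n ∈ Icc 1 X, ‖seqConv a a n‖ ^ 2 / n ≤ C ^ 4 * (majorantConst 4 4 * Real.log X ^ 4) := by
  have hC : 0 ≤ C := (norm_nonneg _).trans (ha 1 one_ne_zero)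
  have ha' : ∀ n, n ≠ 0 → ‖a n‖ ≤ C * tau 1 n := fun n hn => by rw [tau_one_apply hn, mul_one]; exact ha n hn
  have hpt : ∀ n, ‖seqConv a a n‖ ≤ C * C * tau 2 n := norm_seqConv_le_tau hC ha' ha'
  have key := sum_tau_sq_div_le 2 hX
  calc ∑ n ∈ Icc 1 X, ‖seqConv a a n‖ ^ 2 / n
      ≤ ∑ n ∈ Icc 1 X, C ^ 4 * (tau 2 n ^ 2 / n) := sum_le_sum fun n _ => by
        have e : C ^ 4 * (tau 2 n ^ 2 / n) = (C * C * tau 2 n) ^ 2 / n := by ring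
        rw [e]
        exact div_le_div_of_nonneg_right
          (pow_le_pow_left₀ (norm_nonneg _) (hpt n) 2) (by positivity)
    _ = C ^ 4 * ∑ n ∈ Icc 1 X, tau 2 n ^ 2 / n := by rw [mul_sum]
    _ ≤ C ^ 4 * (majorantConst 4 4 * Real.log X ^ 4) := by
        apply mul_le_mul_of_nonneg_left _ (by positivity)
        simpa using key

/-! ### Part 3. The majorant `|κ| ∗ τ_j` and the general mean-square bound -/

/-- The multiplicative majorant `m ↦ ∑_{m = d l} |κ(d)| τ_j(l) = (|κ| ∗ τ_j)(m)`. [folklore] -/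
def absConvTau (κ : ArithmeticFunction ℂ) (j : ℕ) : ArithmeticFunction ℝ := normAF κ * tau j

/-- Unfolding `absConvTau`. [folklore] -/
theorem absConvTau_apply (κ : ArithmeticFunction ℂ) (j m : ℕ) :
    absConvTau κ j m = ∑ x ∈ m.divisorsAntidiagonal, ‖κ x.1‖ * tau j x.2 := by
  simp only [absConvTau, mul_apply, normAF_apply]

/-- `absConvTau κ j` is multiplicative when `κ` is. [folklore] -/
theorem isMultiplicative_absConvTau {κ : ArithmeticFunction ℂ} (hκ : κ.IsMultiplicative) (j : ℕ) :
    (absConvTau κ j).IsMultiplicative :=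
  (isMultiplicative_normAF hκ).mul (isMultiplicative_tau j)

/-- `0 ≤ absConvTau κ j m`. [folklore] -/
theorem absConvTau_nonneg (κ : ArithmeticFunction ℂ) (j m : ℕ) : 0 ≤ absConvTau κ j m := by
  rw [absConvTau_apply]
  exact sum_nonneg fun x _ => mul_nonneg (norm_nonneg _) (tau_nonneg _ _)

/-- At a prime: `absConvTau κ j p = |κ(p)| + j` (`κ` multiplicative). [folklore] -/
theorem absConvTau_prime {κ : ArithmeticFunction ℂ} (hκ : κ.IsMultiplicative) (j : ℕ) {p : ℕ}
    (hp : p.Prime) : absConvTau κ j p = ‖κ p‖ + j := by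
  rw [absConvTau, mul_apply_prime (isMultiplicative_normAF hκ).map_one (tau_apply_one j) hp,
    normAF_apply, tau_prime j hp]

/-- Products at prime powers, real version: if `0 ≤ f(p^i) ≤ (i+1)^c` and `0 ≤ g(p^i) ≤ (i+1)^e`
then `(f ∗ g)(p^k) ≤ (k+1)^{c+e+1}`. [folklore] -/
theorem mul_apply_prime_pow_le_of_nonneg {f g : ArithmeticFunction ℝ} {p : ℕ} (hp : p.Prime)
    {c e : ℕ} (hf : ∀ i : ℕ, f (p ^ i) ≤ ((i : ℝ) + 1) ^ c) (hg : ∀ i : ℕ, g (p ^ i) ≤ ((i : ℝ) + 1) ^ e)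
    (hg0 : ∀ i : ℕ, 0 ≤ g (p ^ i)) (k : ℕ) :
    (f * g) (p ^ k) ≤ ((k : ℝ) + 1) ^ (c + e + 1) := by
  rw [RankinEisenstein.mul_apply_prime_pow f g hp k]
  calc ∑ i ∈ range (k + 1), f (p ^ i) * g (p ^ (k - i))
      ≤ ∑ i ∈ range (k + 1), ((k : ℝ) + 1) ^ c * ((k : ℝ) + 1) ^ e := sum_le_sum fun i hi => by
        have hik : i ≤ k := Nat.lt_succ_iff.mp (mem_range.1 hi)
        have h1 : (i : ℝ) + 1 ≤ (k : ℝ) + 1 := by exact_mod_cast Nat.succ_le_succ hik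
        have h2 : ((k - i : ℕ) : ℝ) + 1 ≤ (k : ℝ) + 1 := by
          exact_mod_cast Nat.succ_le_succ (Nat.sub_le k i)
        exact mul_le_mul ((hf i).trans (pow_le_pow_left₀ (by positivity) h1 c))
          ((hg _).trans (pow_le_pow_left₀ (by positivity) h2 e)) (hg0 _) (by positivity)
    _ = ((k : ℝ) + 1) ^ (c + e + 1) := by
        rw [sum_const, card_range, nsmul_eq_mul, pow_add, pow_add, pow_one]; push_cast; ring

/-- If `|κ(p^i)| ≤ (i+1)^c` for all `i` then `absConvTau κ j (p^ν) ≤ (ν+1)^{c+j+1}`. [folklore] -/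
theorem absConvTau_prime_pow_le {κ : ArithmeticFunction ℂ} (j : ℕ) {p : ℕ} (hp : p.Prime) {c : ℕ}
    (hκpow : ∀ i : ℕ, ‖κ (p ^ i)‖ ≤ ((i : ℝ) + 1) ^ c) (ν : ℕ) :
    absConvTau κ j (p ^ ν) ≤ ((ν : ℝ) + 1) ^ (c + j + 1) :=
  mul_apply_prime_pow_le_of_nonneg hp (f := normAF κ) (g := tau j)
    (fun i => by rw [normAF_apply]; exact hκpow i) (fun i => tau_prime_pow_le j hp i)
    (fun i => tau_nonneg _ _) ν

/-- Pointwise: `|(κ ∗ w)(m)| ≤ C · (|κ| ∗ τ_j)(m)` when `|w(n)| ≤ C τ_j(n)` for `n ≥ 1`. [folklore] -/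
theorem norm_conv_le_of_le_tau {κ : ArithmeticFunction ℂ} {w : ℕ → ℂ} {C : ℝ} {j : ℕ}
    (hw : ∀ n, n ≠ 0 → ‖w n‖ ≤ C * tau j n) (m : ℕ) :
    ‖conv κ w m‖ ≤ C * absConvTau κ j m := by
  calc ‖conv κ w m‖ ≤ ∑ x ∈ m.divisorsAntidiagonal, ‖κ x.1 * w x.2‖ := norm_sum_le _ _
    _ ≤ ∑ x ∈ m.divisorsAntidiagonal, C * (‖κ x.1‖ * tau j x.2) := sum_le_sum fun x hx => by
        have hx' := Nat.mem_divisorsAntidiagonal.1 hx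
        have h2 : x.2 ≠ 0 := by intro h; apply hx'.2; rw [← hx'.1, h, mul_zero]
        rw [norm_mul]
        calc ‖κ x.1‖ * ‖w x.2‖ ≤ ‖κ x.1‖ * (C * tau j x.2) :=
              mul_le_mul_of_nonneg_left (hw _ h2) (norm_nonneg _)
          _ = C * (‖κ x.1‖ * tau j x.2) := by ring
    _ = C * absConvTau κ j m := by rw [absConvTau_apply, mul_sum]

/-- **Mean square of `κ ∗ w` for a divisor-bounded `w`.** Let `κ : ArithmeticFunction ℂ` be
multiplicative with `|κ(p)| ≤ a₀ + B log p`, `|κ(p)| ≤ A₀` (`B ≥ 0`), `|κ(p^i)| ≤ (i+1)^c`, and let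
`|w(n)| ≤ C τ_j(n)` for `n ≥ 1`, where `a₀ + j ≤ 3` and `A₀ + j ≤ 5`. Then for `X ≥ 2`,
`∑_{m≤X} |(κ ∗ w)(m)|²/m ≤ C² · majorantConst 9 (2(c+j+1)) · exp(16B log 4X) · (log X)^9`
(`sum_sq_div_le` for `g = |κ| ∗ τ_j`: `g(p) = |κ(p)| + j ≤ 3 + B log p`, `g(p) ≤ 5`,
`g(p^ν) ≤ (ν+1)^{c+j+1}`). [folklore] -/
theorem sum_norm_conv_sq_div_le_of_le_tau {κ : ArithmeticFunction ℂ} (hκ : κ.IsMultiplicative)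
    {B C a₀ A₀ : ℝ} (hB : 0 ≤ B) {j c : ℕ} (ha3 : a₀ + j ≤ 3) (hA5 : A₀ + j ≤ 5)
    (hκp : ∀ p, p.Prime → ‖κ p‖ ≤ a₀ + B * Real.log p) (hκpA : ∀ p, p.Prime → ‖κ p‖ ≤ A₀)
    (hκpow : ∀ p i : ℕ, p.Prime → ‖κ (p ^ i)‖ ≤ ((i : ℝ) + 1) ^ c)
    {w : ℕ → ℂ} (hw : ∀ n, n ≠ 0 → ‖w n‖ ≤ C * tau j n) {X : ℕ} (hX : 2 ≤ X) :
    ∑ m ∈ Icc 1 X, ‖conv κ w m‖ ^ 2 / m ≤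
      C ^ 2 * (majorantConst 9 (2 * (c + j + 1)) * Real.exp (16 * B * Real.log (4 * X)) *
        Real.log X ^ 9) := by
  have hg := isMultiplicative_absConvTau hκ j
  have key := sum_sq_div_le (g := fun n => absConvTau κ j n) (d := c + j + 1) hg.map_one
    (fun m n h => hg.map_mul_of_coprime h) (absConvTau_nonneg κ j) hB
    (fun p hp => by rw [absConvTau_prime hκ j hp]; linarith [hκp p hp])
    (fun p hp => by rw [absConvTau_prime hκ j hp]; linarith [hκpA p hp])
    (fun p ν hp => absConvTau_prime_pow_le j hp (fun i => hκpow p i hp) ν) hX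
  calc ∑ m ∈ Icc 1 X, ‖conv κ w m‖ ^ 2 / m
      ≤ ∑ m ∈ Icc 1 X, C ^ 2 * (absConvTau κ j m ^ 2 / m) := sum_le_sum fun m _ => by
        rw [← mul_div_assoc, ← mul_pow]
        exact div_le_div_of_nonneg_right
          (pow_le_pow_left₀ (norm_nonneg _) (norm_conv_le_of_le_tau hw m) 2) (by positivity)
    _ = C ^ 2 * ∑ m ∈ Icc 1 X, absConvTau κ j m ^ 2 / m := by rw [mul_sum]
    _ ≤ _ := mul_le_mul_of_nonneg_left key (sq_nonneg _)

/-- The normalisation step shared by the corollaries: `B log X ≤ L`, `X ≥ 4`, `B ≥ 0` ⇒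
`exp(16B log 4X) ≤ exp(32L)` (`log 4X ≤ 2 log X`). [folklore] -/
theorem exp_sixteen_mul_log_le {B L : ℝ} (hB : 0 ≤ B) {X : ℕ} (hX : 4 ≤ X)
    (hL : B * Real.log X ≤ L) : Real.exp (16 * B * Real.log (4 * X)) ≤ Real.exp (32 * L) := by
  have hX' : (4 : ℝ) ≤ X := by exact_mod_cast hX
  have hX0 : (0 : ℝ) < X := by linarith
  have hlog : Real.log (4 * X) ≤ 2 * Real.log X := by
    calc Real.log (4 * X) ≤ Real.log (X * X) := Real.log_le_log (by positivity) (by nlinarith)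
      _ = 2 * Real.log X := by rw [Real.log_mul hX0.ne' hX0.ne']; ring
  apply Real.exp_le_exp.2
  calc 16 * B * Real.log (4 * X) ≤ 16 * B * (2 * Real.log X) :=
        mul_le_mul_of_nonneg_left hlog (by positivity)
    _ = 32 * (B * Real.log X) := by ring
    _ ≤ 32 * L := by linarith

/-! ### Part 4. The source's `κ₁` and `κ₂` -/

/-- **Zhang's `κ₁`** [p. 30]: `∑_m κ₁(m) m^{-s} = ζ(s+β₁)ζ(s+β₂)/ζ(s)`, `β_j = i b_j`, DEFINED as the
Dirichlet convolution `n^{-β₁} ∗ n^{-β₂} ∗ μ`. [cite: Zhang2022LandauSiegel, §15 p. 30 (definition of κ₁), (2.13) p. 5] -/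
def kappa₁ (b₁ b₂ : ℝ) : ArithmeticFunction ℂ :=
  powI b₁ * powI b₂ * (ArithmeticFunction.moebius : ArithmeticFunction ℂ)

/-- **Zhang's `κ₂`** [p. 33]: `∑_n κ₂(n) n^{-s} = ζ(s+β₁)/ζ(s)`, `β₁ = i b₁`, DEFINED as the Dirichlet
convolution `n^{-β₁} ∗ μ`. [cite: Zhang2022LandauSiegel, §16 p. 33 (definition of κ₂), (2.13) p. 5] -/
def kappa₂ (b₁ : ℝ) : ArithmeticFunction ℂ :=
  powI b₁ * (ArithmeticFunction.moebius : ArithmeticFunction ℂ)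

/-- `κ₁` is multiplicative. [folklore] -/
theorem isMultiplicative_kappa₁ (b₁ b₂ : ℝ) : (kappa₁ b₁ b₂).IsMultiplicative :=
  ((isMultiplicative_powI b₁).mul (isMultiplicative_powI b₂)).mul isMultiplicative_moebius_complex

/-- `κ₂` is multiplicative. [folklore] -/
theorem isMultiplicative_kappa₂ (b₁ : ℝ) : (kappa₂ b₁).IsMultiplicative :=
  (isMultiplicative_powI b₁).mul isMultiplicative_moebius_complex

/-- `κ₁(p) = p^{-β₁} + p^{-β₂} − 1` at a prime `p`. [cite: Zhang2022LandauSiegel, §15 p. 30] -/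
theorem kappa₁_apply_prime (b₁ b₂ : ℝ) {p : ℕ} (hp : p.Prime) :
    kappa₁ b₁ b₂ p = powI b₁ p + powI b₂ p - 1 := by
  have h1 := isMultiplicative_powI b₁
  have h12 := h1.mul (isMultiplicative_powI b₂)
  rw [kappa₁, mul_apply_prime h12.map_one isMultiplicative_moebius_complex.map_one hp,
    mul_apply_prime h1.map_one (isMultiplicative_powI b₂).map_one hp,
    moebius_complex_apply_prime hp]
  ring

/-- `κ₂(p) = p^{-β₁} − 1` at a prime `p`. [cite: Zhang2022LandauSiegel, §16 p. 33] -/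
theorem kappa₂_apply_prime (b₁ : ℝ) {p : ℕ} (hp : p.Prime) :
    kappa₂ b₁ p = powI b₁ p - 1 := by
  rw [kappa₂, mul_apply_prime (isMultiplicative_powI b₁).map_one
    isMultiplicative_moebius_complex.map_one hp, moebius_complex_apply_prime hp]
  ring

/-- `|κ₁(p)| ≤ 1 + (|b₁| + |b₂|) log p`: two unimodular shifts minus Möbius' `−1`. [folklore] -/
theorem norm_kappa₁_prime_le (b₁ b₂ : ℝ) {p : ℕ} (hp : p.Prime) :
    ‖kappa₁ b₁ b₂ p‖ ≤ 1 + (|b₁| + |b₂|) * Real.log p := by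
  rw [kappa₁_apply_prime b₁ b₂ hp]
  have h1 := norm_powI_sub_one_le b₁ hp.pos
  have h2 := norm_powI_sub_one_le b₂ hp.pos
  have e : powI b₁ p + powI b₂ p - 1 = (powI b₁ p - 1) + (powI b₂ p - 1) + 1 := by ring
  rw [e]
  calc ‖(powI b₁ p - 1) + (powI b₂ p - 1) + 1‖
      ≤ ‖(powI b₁ p - 1) + (powI b₂ p - 1)‖ + ‖(1 : ℂ)‖ := norm_add_le _ _
    _ ≤ ‖powI b₁ p - 1‖ + ‖powI b₂ p - 1‖ + 1 := by
        rw [norm_one]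
        gcongr
        exact norm_add_le _ _
    _ ≤ |b₁| * Real.log p + |b₂| * Real.log p + 1 := by linarith
    _ = 1 + (|b₁| + |b₂|) * Real.log p := by ring

/-- `|κ₁(p)| ≤ 3`. [folklore] -/
theorem norm_kappa₁_prime_le_three (b₁ b₂ : ℝ) {p : ℕ} (hp : p.Prime) :
    ‖kappa₁ b₁ b₂ p‖ ≤ 3 := by
  rw [kappa₁_apply_prime b₁ b₂ hp]
  have h1 := norm_powI_of_pos b₁ hp.pos
  have h2 := norm_powI_of_pos b₂ hp.pos
  calc ‖powI b₁ p + powI b₂ p - 1‖ ≤ ‖powI b₁ p + powI b₂ p‖ + ‖(1 : ℂ)‖ := norm_sub_le _ _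
    _ ≤ ‖powI b₁ p‖ + ‖powI b₂ p‖ + 1 := by
        rw [norm_one]
        gcongr
        exact norm_add_le _ _
    _ = 3 := by rw [h1, h2]; norm_num

/-- `|κ₁(p^k)| ≤ (k+1)²`. [folklore] -/
theorem norm_kappa₁_prime_pow_le (b₁ b₂ : ℝ) {p : ℕ} (hp : p.Prime) (k : ℕ) :
    ‖kappa₁ b₁ b₂ (p ^ k)‖ ≤ ((k : ℝ) + 1) ^ 2 := by
  have hI : ∀ (b : ℝ) (i : ℕ), ‖powI b (p ^ i)‖ ≤ 1 := fun b i =>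
    (norm_powI_of_pos b (pow_pos hp.pos i)).le
  have h0 : ∀ i : ℕ, ‖powI b₁ (p ^ i)‖ ≤ ((i : ℝ) + 1) ^ 0 := fun i => by
    rw [pow_zero]; exact hI b₁ i
  have h1 : ∀ i : ℕ, ‖(powI b₁ * powI b₂) (p ^ i)‖ ≤ ((i : ℝ) + 1) ^ 1 :=
    norm_mul_apply_prime_pow_le hp h0 (hI b₂)
  exact norm_mul_apply_prime_pow_le hp h1 (fun j => norm_moebius_complex_le_one _) k

/-- `|κ₂(p)| ≤ |b₁| log p` (`a₀ = 0`: one unimodular shift minus Möbius' `−1`). [folklore] -/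
theorem norm_kappa₂_prime_le (b₁ : ℝ) {p : ℕ} (hp : p.Prime) :
    ‖kappa₂ b₁ p‖ ≤ |b₁| * Real.log p := by
  rw [kappa₂_apply_prime b₁ hp]
  exact norm_powI_sub_one_le b₁ hp.pos

/-- `|κ₂(p)| ≤ 2`. [folklore] -/
theorem norm_kappa₂_prime_le_two (b₁ : ℝ) {p : ℕ} (hp : p.Prime) : ‖kappa₂ b₁ p‖ ≤ 2 := by
  rw [kappa₂_apply_prime b₁ hp]
  have h1 := norm_powI_of_pos b₁ hp.pos
  calc ‖powI b₁ p - 1‖ ≤ ‖powI b₁ p‖ + ‖(1 : ℂ)‖ := norm_sub_le _ _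
    _ = 2 := by rw [h1, norm_one]; norm_num

/-- `|κ₂(p^k)| ≤ k+1`. [folklore] -/
theorem norm_kappa₂_prime_pow_le (b₁ : ℝ) {p : ℕ} (hp : p.Prime) (k : ℕ) :
    ‖kappa₂ b₁ (p ^ k)‖ ≤ ((k : ℝ) + 1) ^ 1 := by
  have hI : ∀ i : ℕ, ‖powI b₁ (p ^ i)‖ ≤ ((i : ℝ) + 1) ^ 0 := fun i => by
    rw [pow_zero]; exact (norm_powI_of_pos b₁ (pow_pos hp.pos i)).le
  exact norm_mul_apply_prime_pow_le hp hI (fun j => norm_moebius_complex_le_one _) k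

/-! ### Part 5. The two Proposition 14.1 call sites -/

/-- **(15.5), the mean-square input with exponent `9`.** For Zhang's `κ₁` (purely imaginary shifts
`β_j = i b_j`) and ANY sequence `b` with `|b(n)| ≤ C τ₂(n)` for `n ≥ 1` ((15.2): `b ≪ τ₂`), for `X ≥ 2`:
`∑_{m≤X} |(κ₁ ∗ b)(m)|²/m ≤ C² · majorantConst 9 10 · exp(16(|b₁|+|b₂|) log 4X) · (log X)^9`.
Under the printed interface (14.1) `κ₁* = κ₁ ∗ b ≪ τ₃ ∗ τ₂ = τ₅` the source's count is `(log P²)^{25}`;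
nothing about the manuscript's theorems is asserted.
[cite: Zhang2022LandauSiegel, §15 (15.5) p. 30 with §14 (14.1)–(14.3) p. 28] -/
theorem sum_norm_kappa₁_conv_sq_div_le (b₁ b₂ : ℝ) {b : ℕ → ℂ} {C : ℝ}
    (hb : ∀ n, n ≠ 0 → ‖b n‖ ≤ C * tau 2 n) {X : ℕ} (hX : 2 ≤ X) :
    ∑ m ∈ Icc 1 X, ‖conv (kappa₁ b₁ b₂) b m‖ ^ 2 / m ≤
      C ^ 2 * (majorantConst 9 10 *
        Real.exp (16 * (|b₁| + |b₂|) * Real.log (4 * X)) * Real.log X ^ 9) :=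
  sum_norm_conv_sq_div_le_of_le_tau (isMultiplicative_kappa₁ b₁ b₂) (by positivity)
    (a₀ := 1) (A₀ := 3) (j := 2) (c := 2) (by norm_num) (by norm_num)
    (fun p hp => norm_kappa₁_prime_le b₁ b₂ hp)
    (fun p hp => norm_kappa₁_prime_le_three b₁ b₂ hp)
    (fun p i hp => norm_kappa₁_prime_pow_le b₁ b₂ hp i) hb hX

/-- **(15.5) in the source's normalisation.** If moreover `(|b₁|+|b₂|) · log X ≤ L` and `X ≥ 4`
(in the source `X = P²`, `|b₁|+|b₂| = α(3 − 3c′α𝓛) ≤ 3α` by (2.13), `α log P² = 2π` by (2.10), so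
`L = 6π`), then `∑_{m≤X} |(κ₁ ∗ b)(m)|²/m ≤ C² · majorantConst 9 10 · e^{32L} · (log X)^9` —
`O(1) · (log P²)^9`: exponent `k = 9` of the cell's hypothesis (14.1′) at (15.5).
[cite: Zhang2022LandauSiegel, §15 (15.5) p. 30, (2.10) p. 4, (2.13) p. 5] -/
theorem sum_norm_kappa₁_conv_sq_div_le_of_mul_log_le (b₁ b₂ : ℝ) {b : ℕ → ℂ} {C L : ℝ}
    (hb : ∀ n, n ≠ 0 → ‖b n‖ ≤ C * tau 2 n) {X : ℕ} (hX : 4 ≤ X)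
    (hL : (|b₁| + |b₂|) * Real.log X ≤ L) :
    ∑ m ∈ Icc 1 X, ‖conv (kappa₁ b₁ b₂) b m‖ ^ 2 / m ≤
      C ^ 2 * majorantConst 9 10 * Real.exp (32 * L) * Real.log X ^ 9 := by
  have h := sum_norm_kappa₁_conv_sq_div_le b₁ b₂ hb (le_trans (by norm_num) hX)
  have hexp := exp_sixteen_mul_log_le (B := |b₁| + |b₂|) (by positivity) hX hL
  have hM : 0 ≤ majorantConst 9 10 := (majorantConst_pos 9 10).le
  have hX' : (4 : ℝ) ≤ X := by exact_mod_cast hX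
  have hL9 : 0 ≤ Real.log X ^ 9 := pow_nonneg (Real.log_nonneg (by linarith)) 9
  calc ∑ m ∈ Icc 1 X, ‖conv (kappa₁ b₁ b₂) b m‖ ^ 2 / m ≤ _ := h
    _ ≤ C ^ 2 * (majorantConst 9 10 * Real.exp (32 * L) * Real.log X ^ 9) := by
        apply mul_le_mul_of_nonneg_left _ (sq_nonneg _)
        exact mul_le_mul_of_nonneg_right (mul_le_mul_of_nonneg_left hexp hM) hL9
    _ = C ^ 2 * majorantConst 9 10 * Real.exp (32 * L) * Real.log X ^ 9 := by ring

/-- **(16.1), the mean-square input with exponent `9`.** For Zhang's `κ₂` (purely imaginary shift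
`β₁ = i b₁`) and ANY sequence `b₁` with `|b₁(n)| ≤ C τ₃(n)` for `n ≥ 1` (`b₁ = b ⋆ (n^{-β₃}g*(T²/n))`,
`b ≪ τ₂` by (15.2), so `b₁ ≪ τ₃` by `norm_seqConv_le_tau`), for `X ≥ 2`:
`∑_{m≤X} |(κ₂ ∗ b₁)(m)|²/m ≤ C² · majorantConst 9 10 · exp(16|b₁| log 4X) · (log X)^9`. Under the
printed interface (14.1) `κ₂* = κ₂ ∗ b₁ ≪ τ₂ ∗ τ₃ = τ₅` the source's count is `(log P²)^{25}`;
nothing about the manuscript's theorems is asserted.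
[cite: Zhang2022LandauSiegel, §16 (16.1) p. 33 with §14 (14.1)–(14.3) p. 28 and Lemma 6.1 p. 12] -/
theorem sum_norm_kappa₂_conv_sq_div_le (b₁ : ℝ) {w : ℕ → ℂ} {C : ℝ}
    (hw : ∀ n, n ≠ 0 → ‖w n‖ ≤ C * tau 3 n) {X : ℕ} (hX : 2 ≤ X) :
    ∑ m ∈ Icc 1 X, ‖conv (kappa₂ b₁) w m‖ ^ 2 / m ≤
      C ^ 2 * (majorantConst 9 10 * Real.exp (16 * |b₁| * Real.log (4 * X)) * Real.log X ^ 9) :=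
  sum_norm_conv_sq_div_le_of_le_tau (isMultiplicative_kappa₂ b₁) (abs_nonneg b₁)
    (a₀ := 0) (A₀ := 2) (j := 3) (c := 1) (by norm_num) (by norm_num)
    (fun p hp => (norm_kappa₂_prime_le b₁ hp).trans_eq (zero_add _).symm)
    (fun p hp => norm_kappa₂_prime_le_two b₁ hp)
    (fun p i hp => norm_kappa₂_prime_pow_le b₁ hp i) hw hX

/-- **(16.1) in the source's normalisation.** If moreover `|b₁| · log X ≤ L` and `X ≥ 4` (in the
source `X = P²`, `|b₁| log P² = 2π(1 − 5c′α𝓛) ≤ 2π =: L` by (2.13), (2.10)), then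
`∑_{m≤X} |(κ₂ ∗ b₁)(m)|²/m ≤ C² · majorantConst 9 10 · e^{32L} · (log X)^9` — `O(1) · (log P²)^9`:
exponent `k = 9` of the cell's hypothesis (14.1′) at (16.1).
[cite: Zhang2022LandauSiegel, §16 (16.1) p. 33, (2.10) p. 4, (2.13) p. 5] -/
theorem sum_norm_kappa₂_conv_sq_div_le_of_mul_log_le (b₁ : ℝ) {w : ℕ → ℂ} {C L : ℝ}
    (hw : ∀ n, n ≠ 0 → ‖w n‖ ≤ C * tau 3 n) {X : ℕ} (hX : 4 ≤ X)
    (hL : |b₁| * Real.log X ≤ L) :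
    ∑ m ∈ Icc 1 X, ‖conv (kappa₂ b₁) w m‖ ^ 2 / m ≤
      C ^ 2 * majorantConst 9 10 * Real.exp (32 * L) * Real.log X ^ 9 := by
  have h := sum_norm_kappa₂_conv_sq_div_le b₁ hw (le_trans (by norm_num) hX)
  have hexp := exp_sixteen_mul_log_le (B := |b₁|) (abs_nonneg b₁) hX hL
  have hM : 0 ≤ majorantConst 9 10 := (majorantConst_pos 9 10).le
  have hX' : (4 : ℝ) ≤ X := by exact_mod_cast hX
  have hL9 : 0 ≤ Real.log X ^ 9 := pow_nonneg (Real.log_nonneg (by linarith)) 9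
  calc ∑ m ∈ Icc 1 X, ‖conv (kappa₂ b₁) w m‖ ^ 2 / m ≤ _ := h
    _ ≤ C ^ 2 * (majorantConst 9 10 * Real.exp (32 * L) * Real.log X ^ 9) := by
        apply mul_le_mul_of_nonneg_left _ (sq_nonneg _)
        exact mul_le_mul_of_nonneg_right (mul_le_mul_of_nonneg_left hexp hM) hL9
    _ = C ^ 2 * majorantConst 9 10 * Real.exp (32 * L) * Real.log X ^ 9 := by ring

/-- **(16.1) with the source's data for `b₁ = b ⋆ c`.** If `|b(n)| ≤ C₁ τ₂(n)` ((15.2)) and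
`|c(n)| ≤ C₂` (`c(n) = n^{-β₃} g*(T²/n)`, Lemma 6.1) for `n ≥ 1`, `C₁ ≥ 0`, then for `X ≥ 2`,
`∑_{m≤X} |(κ₂ ∗ (b ⋆ c))(m)|²/m ≤ (C₁C₂)² · majorantConst 9 10 · exp(16|b₁| log 4X) · (log X)^9`.
[cite: Zhang2022LandauSiegel, §16 (16.1) p. 33, §15 (15.2) p. 30, Lemma 6.1 p. 12] -/
theorem sum_norm_kappa₂_conv_seqConv_sq_div_le (b₁ : ℝ) {b c : ℕ → ℂ} {C₁ C₂ : ℝ} (hC₁ : 0 ≤ C₁)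
    (hb : ∀ n, n ≠ 0 → ‖b n‖ ≤ C₁ * tau 2 n) (hc : ∀ n, n ≠ 0 → ‖c n‖ ≤ C₂) {X : ℕ} (hX : 2 ≤ X) :
    ∑ m ∈ Icc 1 X, ‖conv (kappa₂ b₁) (seqConv b c) m‖ ^ 2 / m ≤
      (C₁ * C₂) ^ 2 *
        (majorantConst 9 10 * Real.exp (16 * |b₁| * Real.log (4 * X)) * Real.log X ^ 9) :=
  sum_norm_kappa₂_conv_sq_div_le b₁ (fun n _ => norm_seqConv_le_tau_three hC₁ hb hc n) hX

/-- **The (7.5) instance re-read through the general majorant** (consistency with the §7 companion):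
for Zhang's `κ = kappa b₁ b₂ b₃` and `|a(n)| ≤ C` (`n ≥ 1`; `τ₁ = 𝟙`), the general bound with
`a₀ = 2`, `A₀ = 4`, `j = 1`, `c = 3` gives `C² · majorantConst 9 10 · exp(16(∑|b_j|) log 4X) · (log X)^9`
— the same exponent `9` as `sum_norm_kappa_conv_sq_div_le` (there with the slightly smaller
`majorantConst 9 8`, the hypothesis on `a` being used at `n = 0` too). [folklore] -/
theorem sum_norm_kappa_conv_sq_div_le' (b₁ b₂ b₃ : ℝ) {a : ℕ → ℂ} {C : ℝ}
    (ha : ∀ n, n ≠ 0 → ‖a n‖ ≤ C) {X : ℕ} (hX : 2 ≤ X) :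
    ∑ m ∈ Icc 1 X, ‖conv (kappa b₁ b₂ b₃) a m‖ ^ 2 / m ≤
      C ^ 2 * (majorantConst 9 10 *
        Real.exp (16 * (|b₁| + |b₂| + |b₃|) * Real.log (4 * X)) * Real.log X ^ 9) :=
  sum_norm_conv_sq_div_le_of_le_tau (isMultiplicative_kappa b₁ b₂ b₃) (by positivity)
    (a₀ := 2) (A₀ := 4) (j := 1) (c := 3) (by norm_num) (by norm_num)
    (fun p hp => norm_kappa_prime_le b₁ b₂ b₃ hp)
    (fun p hp => norm_kappa_prime_le_four b₁ b₂ b₃ hp)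
    (fun p i hp => norm_kappa_prime_pow_le b₁ b₂ b₃ hp i)
    (fun n hn => by rw [tau_one_apply hn, mul_one]; exact ha n hn) hX

end Literature.NumberTheory.LFunctions.Zhang2022.MeanSquareMajorant
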